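import Mathlib
import Summits.ValiantsHypothesis.ValiantsHypothesis.Theorems.GrenetZeonPolySizeQPAlgebraLocalReductionEventually
import HarnessLib

/-!
# Crux `GrenetZeon.PolySizeQPAlgebra` (stmt-ValiantsHypothesis-8064), line `vbp-slice-dealg` —
# the reduction of `…LocalReduction` with the local Hessian bound asked only for pieces of dimension `≤ s`

`not_hasAlgDetRepr_perPoly_self_of_localHessianBound` (`…LocalReduction`) asks the type-independent bound
`LocalHessianBound n` for EVERY finite-dimensional local coefficient algebra `R`, but applies it only to the
local pieces of an `(n, s)`-representation, whose dimensions sum to `≤ s`.  The hand chain now proves the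
bound type by type (curvilinear `…JetHessian`; square-zero `…SquareZeroResidue`; `𝔪³ = 0` `…CubeZero`,
covering every type of dimension `≤ 4`), so the useful socket is the DIMENSION-RESTRICTED reduction:

* `not_hasAlgDetRepr_perPoly_self_of_localHessianBound_dim` — the same conclusion `¬ HasAlgDetRepr per_n n s`
  from a good `c`-space (`s < c`, threshold `≥ 2sn`) and the local Hessian bound for algebras `R` with
  `dim_ℂ R ≤ s` only (proof verbatim, recording `dim R_i ≤ Σ dim R_i ≤ s`).
* `corner_all_large_of_localHessianBound_dim_eventually` — the all-large-`n` column form with the bound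
  asked for `dim R ≤ s` and `n ≥ n₁` only.

HONEST FRAMING: bookkeeping of a conditional reduction; no stub of the line is closed; VP ≠ VNP is not
moved.

References: T. Mignon, N. Ressayre, IMRN 2004:79, §2 [MignonRessayre2004].
-/

noncomputable section

open MvPolynomial Matrix
open Literature.Computability.AlgebraicComplexity

-- single-conjunct layout `Summits/ValiantsHypothesis/ValiantsHypothesis`: duplicated namespace by design
set_option linter.dupNamespace false

namespace Summit.ValiantsHypothesis.ValiantsHypothesis.Theorems.GrenetZeonPolySizeQPAlgebra

/-- **Every point `(n, s)` from the local Hessian bound FOR PIECES OF DIMENSION `≤ s` and a good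
`(s+1)`-space.**  As `not_hasAlgDetRepr_perPoly_self_of_localHessianBound`, with the inlined hypothesis
restricted to coefficient algebras `R` with `dim_ℂ R ≤ s` (the pieces of an `(n, s)`-representation have
dimensions summing to `≤ s`). [cite: MignonRessayre2004, §2] -/
theorem not_hasAlgDetRepr_perPoly_self_of_localHessianBound_dim {n s c t : ℕ} (hn : 1 ≤ n)
    (hH : ∀ (R : Type) [CommRing R] [Algebra ℂ R] [Module.Finite ℂ R], Module.finrank ℂ R ≤ s →
      ∀ (φ : R →ₐ[ℂ] ℂ) (ν : ℕ), RingHom.ker (φ : R →+* ℂ) ^ ν = ⊥ →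
      ∀ (l : R →ₗ[ℂ] ℂ), (∀ r : R, (∀ x, l (x * r) = 0) → r = 0) →
      ∀ (A : Matrix (Fin n) (Fin n) (MvPolynomial (Fin n × Fin n) R)) (F : MvPolynomial (Fin n × Fin n) ℂ),
        (∀ a b, (A a b).IsHomogeneous 1) → (∀ d, l (coeff d A.det) = coeff d F) →
        ∀ p : Fin n × Fin n → ℂ, eval (fun i => algebraMap ℂ R (p i)) A.det = 0 →
          (hess0 (transl p F)).rank ≤ 2 * Module.finrank ℂ R * n)
    (hW : ∃ w : Fin c → (Fin n × Fin n → ℂ), LinearIndependent ℂ w ∧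
      ∀ a : Fin c → ℂ, a ≠ 0 → eval (∑ i, a i • w i) (perPoly (Fin n) ℂ) = 0 →
        t < (hess0 (transl (∑ i, a i • w i) (perPoly (Fin n) ℂ))).rank)
    (hsc : s < c) (ht : 2 * s * n ≤ t) : ¬ HasAlgDetRepr (perPoly (Fin n) ℂ) n s := by
  classical
  intro h
  obtain ⟨q, F, dim, -, hdim, hper, -, hloc⟩ := exists_homogeneous_local_frobenius_perPoly h
  have hdimle : ∀ i, dim i ≤ s := fun i =>
    (Finset.single_le_sum (fun j _ => Nat.zero_le (dim j)) (Finset.mem_univ i)).trans hdim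
  -- per-piece data: equations, dimension count, vanishing at `0`, and the rank bound
  have key : ∀ i : Fin q, ∃ (k : ℕ) (g : Fin k → MvPolynomial (Fin n × Fin n) ℂ),
      k + 1 ≤ dim i ∧ (∀ j, eval 0 (g j) = 0) ∧ eval 0 (F i) = 0 ∧
        ∀ p : Fin n × Fin n → ℂ, (∀ j, eval p (g j) = 0) → eval p (F i) = 0 →
          (hess0 (transl p (F i))).rank ≤ 2 * dim i * n := by
    intro i
    obtain ⟨R, _, _, _, φ, hker, hdimR, l, A, hA, hcoeff, hnondeg⟩ := hloc i
    haveI : Nontrivial R := ⟨⟨1, 0, fun h10 => one_ne_zero ((map_one φ).symm.trans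
      (by rw [h10, map_zero]))⟩⟩
    obtain ⟨k, g, hk, hg0, hF0, -, hzero⟩ := exists_piece_equations hn l hnondeg A hA (F i) hcoeff
    refine ⟨k, g, by rw [← hdimR]; exact hk, hg0, hF0, fun p hgp hFp => ?_⟩
    rw [← hdimR]
    exact hH R (by rw [hdimR]; exact hdimle i) φ s hker l hnondeg A (F i) hA hcoeff p (hzero p hgp hFp)
  choose k g hk hg0 hF0 hrank using key
  cases q with
  | zero =>
    rw [Fintype.sum_empty] at hper
    exact perPoly_ne_zero (Fin n) ℂ hper
  | succ q' =>
    set u₁ : Fin (q' + 1) := Fin.last q' with hu₁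
    set G₁ : Finset (MvPolynomial (Fin n × Fin n) ℂ) := (Finset.univ.erase u₁).image F with hG₁
    set G₂ : Finset (MvPolynomial (Fin n × Fin n) ℂ) :=
      Finset.univ.biUnion fun i => Finset.univ.image (g i) with hG₂
    set G : Finset (MvPolynomial (Fin n × Fin n) ℂ) := G₁ ∪ G₂ with hG
    have hsumk : ∑ i : Fin (q' + 1), k i + (q' + 1) ≤ ∑ i, dim i := by
      have h1 : ∑ i : Fin (q' + 1), (k i + 1) ≤ ∑ i, dim i := Finset.sum_le_sum fun i _ => hk i
      rw [Finset.sum_add_distrib, Finset.sum_const, Finset.card_univ, Fintype.card_fin, smul_eq_mul,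
        mul_one] at h1
      exact h1
    have hGcard : G.card + 1 < c := by
      have h1 : G₁.card ≤ q' := by
        refine Finset.card_image_le.trans ?_
        rw [Finset.card_erase_of_mem (Finset.mem_univ _), Finset.card_univ, Fintype.card_fin]
        omega
      have h2 : G₂.card ≤ ∑ i, k i := by
        refine Finset.card_biUnion_le.trans (Finset.sum_le_sum fun i _ => ?_)
        exact Finset.card_image_le.trans (by rw [Finset.card_univ, Fintype.card_fin])
      have h3 : G.card ≤ G₁.card + G₂.card := Finset.card_union_le _ _
      omega
    have hne : ∃ p : Fin n × Fin n → ℂ, eval p (perPoly (Fin n) ℂ) = 0 ∧ ∀ γ ∈ G, eval p γ = 0 := by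
      refine ⟨0, ?_, fun γ hγ => ?_⟩
      · rw [hper, map_sum]
        exact Finset.sum_eq_zero fun i _ => hF0 i
      · rcases Finset.mem_union.1 hγ with hγ | hγ
        · obtain ⟨i, -, rfl⟩ := Finset.mem_image.1 hγ
          exact hF0 i
        · obtain ⟨i, -, hi⟩ := Finset.mem_biUnion.1 hγ
          obtain ⟨j, -, rfl⟩ := Finset.mem_image.1 hi
          exact hg0 i j
    obtain ⟨p, hpper, hpG, hprank⟩ := spaceCriterion hW G hGcard hne
    have hFu : ∀ i, i ≠ u₁ → eval p (F i) = 0 := fun i hi =>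
      hpG _ (Finset.mem_union_left _ (Finset.mem_image.2
        ⟨i, Finset.mem_erase.2 ⟨hi, Finset.mem_univ _⟩, rfl⟩))
    have hFall : ∀ i, eval p (F i) = 0 := by
      intro i
      by_cases hi : i = u₁
      · have hp := hpper
        rw [hper, map_sum, Finset.sum_eq_single u₁ (fun v _ hv => hFu v hv)
          (fun h' => absurd (Finset.mem_univ _) h')] at hp
        rw [hi]; exact hp
      · exact hFu i hi
    have hgall : ∀ i j, eval p (g i j) = 0 := fun i j =>
      hpG _ (Finset.mem_union_right _ (Finset.mem_biUnion.2
        ⟨i, Finset.mem_univ _, Finset.mem_image.2 ⟨j, Finset.mem_univ _, rfl⟩⟩))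
    have hle : (hess0 (transl p (perPoly (Fin n) ℂ))).rank ≤ 2 * s * n := by
      rw [hper, map_sum, map_sum]
      refine (rank_sum_le _ _).trans ?_
      calc ∑ i, (hess0 (transl p (F i))).rank ≤ ∑ i, 2 * dim i * n :=
            Finset.sum_le_sum fun i _ => hrank i p (hgall i) (hFall i)
        _ = 2 * (∑ i, dim i) * n := by rw [Finset.mul_sum, Finset.sum_mul]
        _ ≤ 2 * s * n := by
            exact Nat.mul_le_mul_right _ (Nat.mul_le_mul_left _ hdim)
    omega

/-- **All large `n`, every fixed `s`, from the dimension-`≤ s` local Hessian bound at large `n` only.**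
[folklore] -/
theorem corner_all_large_of_localHessianBound_dim_eventually (s n₁ : ℕ)
    (hH : ∀ n : ℕ, n₁ ≤ n → ∀ (R : Type) [CommRing R] [Algebra ℂ R] [Module.Finite ℂ R],
      Module.finrank ℂ R ≤ s → ∀ (φ : R →ₐ[ℂ] ℂ) (ν : ℕ), RingHom.ker (φ : R →+* ℂ) ^ ν = ⊥ →
      ∀ (l : R →ₗ[ℂ] ℂ), (∀ r : R, (∀ x, l (x * r) = 0) → r = 0) →
      ∀ (A : Matrix (Fin n) (Fin n) (MvPolynomial (Fin n × Fin n) R)) (F : MvPolynomial (Fin n × Fin n) ℂ),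
        (∀ a b, (A a b).IsHomogeneous 1) → (∀ d, l (coeff d A.det) = coeff d F) →
        ∀ p : Fin n × Fin n → ℂ, eval (fun i => algebraMap ℂ R (p i)) A.det = 0 →
          (hess0 (transl p F)).rank ≤ 2 * Module.finrank ℂ R * n)
    (hW : ∃ n₀ : ℕ, ∀ n ≥ n₀, ∃ w : Fin (s + 1) → (Fin n × Fin n → ℂ), LinearIndependent ℂ w ∧
      ∀ a : Fin (s + 1) → ℂ, a ≠ 0 → eval (∑ i, a i • w i) (perPoly (Fin n) ℂ) = 0 →
        2 * s * n < (hess0 (transl (∑ i, a i • w i) (perPoly (Fin n) ℂ))).rank) :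
    ∃ n₀ : ℕ, ∀ n ≥ n₀, ∀ m s' : ℕ, m ≤ n → s' ≤ s → ¬ HasAlgDetRepr (perPoly (Fin n) ℂ) m s' := by
  obtain ⟨n₀, hgood⟩ := hW
  refine ⟨max (max n₀ 1) n₁, fun n hn m s' hm hs' hrep => ?_⟩
  have hn₀ : n₀ ≤ n := le_trans (le_max_left _ _) (le_trans (le_max_left _ _) hn)
  have hn1 : 1 ≤ n := le_trans (le_max_right _ _) (le_trans (le_max_left _ _) hn)
  have hnn₁ : n₁ ≤ n := le_trans (le_max_right _ _) hn
  exact not_hasAlgDetRepr_perPoly_self_of_localHessianBound_dim hn1 (hH n hnn₁) (hgood n hn₀)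
    (Nat.lt_succ_self s) le_rfl (hrep.mono hm hs')

end Summit.ValiantsHypothesis.ValiantsHypothesis.Theorems.GrenetZeonPolySizeQPAlgebra

end
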